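import Mathlib
import HarnessLib
import Summits.HubbardSuperconductivity.HubbardSuperconductivity.Theorems.KLProgrammeKLRegimeEngineTwoLegKernelOfConserving
import Summits.HubbardSuperconductivity.HubbardSuperconductivity.Theorems.KLProgrammeKLRegimeEngineTowerImportP2PlainFromValuesWt

/-!
# Route `KLProgramme` — crux K3 ENGINE (stmt-HubbardSuperconductivity-20437 `KLRegimeEngineV17F2`), stub (b): the KERNEL OBJECT behind the located item
# «(b)-WT4-2LEG-PLAIN-CURRENCY» (k3c2-p3 g18, KL STATUS 2026-08-29 l.9904; pen (R431)(A)) — a PLAIN two-leg line dominates the supremum of the two-leg symbol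

Cell gate-hubbard-kl, seat hubbard-kl-k3c2-p3 (g18; row «sector-counting import»).  ♯4 D (p716737) bound the two-leg import of every block by a PLAIN
(`trivialMultiplier`) weighted line `≤ S₂·4^{−(dk−1)}`.  This file proves the structural half of why that binder is unfillable at deep blocks: for ANY Grassmann
element whose 2-kernel on a `(+,−)` label string is conserving-diagonal, `κ·[k̄₀ = k̄₁]·f(k̄₀)`, and for EVERY frequency–momentum `Q`,

* §1 `card_mul_norm_le_sum_norm_charSum` — torus Fourier inversion in norm: `(P·L²)·‖f Q‖ ≤ Σ_z ‖Σ_{Q′} χ_{Q′}(z)•f Q′‖` (character orthogonality `sum_pchar`);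
* §2 **`norm_symbol_le_fixedTupleL1_two_of_conserving`** — `ε·‖κ‖·(2M·L²)·‖f Q‖ ≤ fixedTupleL1 L M β 1 (sectorisedKernel … trivialMultiplier 𝒱 2) τ y` (the dictionary
  `fixedTupleL1_two_eq_of_conserving`, p3/g16, is an EQUALITY with `ε·‖κ‖·Σ_z‖S[f](z)‖`); with `ε = β/(2M)` the left side is `βL²·‖κ‖·‖f Q‖` — the two-leg symbol in natural units;
* §3 **`norm_symbol_le_wtPinnedLine_two_of_conserving`** — the same for the `klScaleWt_j`-WEIGHTED line at the pinned leg `0` (♯4 D's `hS₂` left side at `q = 0`), since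
  `1 ≤ klScaleWt` (`one_le_klScaleWt`).
So a bound `weighted plain two-leg line ≤ S₂·4^{−(dk−1)}` forces `βL²‖κ‖·sup_Q‖f Q‖ ≤ S₂·4^{−(dk−1)}`; the frame being frequency-independent, `sup_Q‖f Q‖ ≥ |Im Σ_{>Λ_{dk}}(iω,k)|`,
which does not decay in `dk` (memo TWO-LEG-PLAIN-LINE-CURRENCY.md §2: ≥ 0.0069·U² float-free, ≈ 0.019·U² float) — that arithmetic is NOT formalised here.
Everything is proved; no definitions; the kernel hypothesis is asserted for no engine object; nothing asserts (b), any stub, K3 or superconductivity. [folklore]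
References: BGM 2006 §2.3 (2.17) [cite: BenfattoGiulianiMastropietro2006]; Katznelson, *Harmonic Analysis* Ch. I §1 (Fourier inversion on a finite abelian group).
-/

noncomputable section

namespace Summit.HubbardSuperconductivity.HubbardSuperconductivity.Theorems.TorusFourierL2

set_option linter.dupNamespace false -- summit = problem name (single-conjunct summit), D-0017

open Finset Complex Literature.Probability.LatticeModels Literature.MathematicalPhysics.QuantumLattice
open Literature.MathematicalPhysics.QuantumLattice.GrassmannAlgebra
open Summit.HubbardSuperconductivity.HubbardSuperconductivity.Theorems.KLRegimeSplit
open Summit.HubbardSuperconductivity.HubbardSuperconductivity.Theorems.KLProgrammeLegKernels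
open Summit.HubbardSuperconductivity.HubbardSuperconductivity.Theorems.EngineV8
open scoped Real ComplexConjugate

/-! ### §1 Fourier inversion in norm on the product torus `(ℤ/P)¹ × (ℤ/L)²` -/

section Inversion

variable {P L : ℕ} [NeZero P] [NeZero L]

/-- **Character-sum inversion**: `Σ_z χ̄_{−Q}(z)·(Σ_{Q′} χ̄_{Q′}(z)•f Q′) = (P·L²)·f Q`. [folklore] -/
theorem sum_pchar_neg_mul_charSum_eq (f : TorusSite 1 P × TorusSite 2 L → ℂ) (Q : TorusSite 1 P × TorusSite 2 L) :
    ∑ z : TorusSite 1 P × TorusSite 2 L, (torusChar (-Q).1 z.1 * torusChar (-Q).2 z.2) *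
        (∑ Q' : TorusSite 1 P × TorusSite 2 L, (torusChar Q'.1 z.1 * torusChar Q'.2 z.2) • f Q') = ((P : ℂ) * (L : ℂ) ^ 2) * f Q := by
  classical
  simp_rw [smul_eq_mul, mul_sum]
  rw [sum_comm]
  have hz : ∀ Q' : TorusSite 1 P × TorusSite 2 L, ∑ z : TorusSite 1 P × TorusSite 2 L,
      (torusChar (-Q).1 z.1 * torusChar (-Q).2 z.2) * ((torusChar Q'.1 z.1 * torusChar Q'.2 z.2) * f Q') =
        (if -Q + Q' = 0 then ((P : ℂ) * (L : ℂ) ^ 2) else 0) * f Q' := by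
    intro Q'
    have hterm : ∀ z : TorusSite 1 P × TorusSite 2 L,
        (torusChar (-Q).1 z.1 * torusChar (-Q).2 z.2) * ((torusChar Q'.1 z.1 * torusChar Q'.2 z.2) * f Q') =
          (torusChar z.1 (-Q + Q').1 * torusChar z.2 (-Q + Q').2) * f Q' := by
      intro z
      rw [← mul_assoc, ← pchar_add_left, torusChar_comm (-Q + Q').1, torusChar_comm (-Q + Q').2]
    simp_rw [hterm]
    rw [← sum_mul, sum_pchar]
  simp_rw [hz]
  simp_rw [neg_add_eq_zero, ite_mul, zero_mul]
  rw [Finset.sum_ite_eq univ Q, if_pos (mem_univ _)]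

/-- **Fourier inversion in norm**: `(P·L²)·‖f Q‖ ≤ Σ_z ‖Σ_{Q′} χ̄_{Q′}(z)•f Q′‖` for every `Q`. [folklore] -/
theorem card_mul_norm_le_sum_norm_charSum (f : TorusSite 1 P × TorusSite 2 L → ℂ) (Q : TorusSite 1 P × TorusSite 2 L) :
    ((P : ℝ) * (L : ℝ) ^ 2) * ‖f Q‖ ≤
      ∑ z : TorusSite 1 P × TorusSite 2 L, ‖∑ Q' : TorusSite 1 P × TorusSite 2 L, (torusChar Q'.1 z.1 * torusChar Q'.2 z.2) • f Q'‖ := by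
  have h := sum_pchar_neg_mul_charSum_eq f Q
  have hn : ‖((P : ℂ) * (L : ℂ) ^ 2) * f Q‖ = ((P : ℝ) * (L : ℝ) ^ 2) * ‖f Q‖ := by
    rw [norm_mul, norm_mul, norm_pow, Complex.norm_natCast, Complex.norm_natCast]
  rw [← hn, ← h]
  refine (norm_sum_le _ _).trans (sum_le_sum fun z _ => ?_)
  rw [norm_mul, norm_mul, norm_torusChar, norm_torusChar, one_mul, one_mul]

end Inversion

/-! ### §2 The plain two-leg line dominates the symbol -/

variable {L M : ℕ} [NeZero L] [NeZero M]

/-- **THE PLAIN TWO-LEG PINNED LINE OF A CONSERVING QUADRATIC DOMINATES ITS SYMBOL, POINTWISE**: for `K k = κ·[k̄₀ = k̄₁]·f(k̄₀)` on the string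
`((0,σ i),![0,1] i)` and every frequency–momentum `Q`, `ε·‖κ‖·(2M·L²)·‖f Q‖ ≤ fixedTupleL1 L M β 1 (sectorisedKernel … trivialMultiplier 𝒱 2) ((0,σ i),![0,1] i) y`
(`= βL²·‖κ‖·‖f Q‖` since `ε = β/(2M)`). [cite: BenfattoGiulianiMastropietro2006, §2.3 (2.17)] -/
theorem norm_symbol_le_fixedTupleL1_two_of_conserving {β : ℝ} (hβ : 0 < β) (𝒱 : HubbardGrassmann L M) (σ : Fin 2 → Fin 2) (κ : ℂ)
    (f : TorusSite 1 (2 * M) × TorusSite 2 L → ℂ)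
    (hker : ∀ k : Fin 2 → FreqMomentum L M, kernel ℂ 𝒱 2 (fun i => ((k i, σ i), (![0, 1] : Fin 2 → Fin 2) i)) = κ * (if ((fun _ : Fin 1 => (((k 0).1 : ℕ) : ZMod (2 * M))), (k 0).2) = (((fun _ : Fin 1 => (((k 1).1 : ℕ) : ZMod (2 * M))), (k 1).2) : TorusSite 1 (2 * M) × TorusSite 2 L) then f ((fun _ : Fin 1 => (((k 0).1 : ℕ) : ZMod (2 * M))), (k 0).2) else 0))
    (y : SpaceTimeIdx L M) (Q : TorusSite 1 (2 * M) × TorusSite 2 L) :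
    imagTimeWeight β M * ‖κ‖ * ((((2 * M : ℕ) : ℝ)) * (L : ℝ) ^ 2) * ‖f Q‖ ≤
      fixedTupleL1 L M β 1 (sectorisedKernel L M β (trivialMultiplier L M) 𝒱 2) (fun i : Fin 2 => ((((0 : Fin 1), σ i) : Fin 1 × Fin 2), (![0, 1] : Fin 2 → Fin 2) i)) y := by
  rw [fixedTupleL1_two_eq_of_conserving hβ 𝒱 σ κ f hker y]
  have hε : 0 ≤ imagTimeWeight β M := imagTimeWeight_nonneg hβ.le M
  have h1 := card_mul_norm_le_sum_norm_charSum (P := 2 * M) f Q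
  calc imagTimeWeight β M * ‖κ‖ * ((((2 * M : ℕ) : ℝ)) * (L : ℝ) ^ 2) * ‖f Q‖
      = imagTimeWeight β M * (‖κ‖ * (((((2 * M : ℕ) : ℝ)) * (L : ℝ) ^ 2) * ‖f Q‖)) := by ring
    _ ≤ imagTimeWeight β M * (‖κ‖ * ∑ z : TorusSite 1 (2 * M) × TorusSite 2 L,
          ‖∑ Q' : TorusSite 1 (2 * M) × TorusSite 2 L, (torusChar Q'.1 z.1 * torusChar Q'.2 z.2) • f Q'‖) :=
        mul_le_mul_of_nonneg_left (mul_le_mul_of_nonneg_left h1 (norm_nonneg _)) hε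

/-- The same with `ε·(2M) = β` made explicit: `β·L²·‖κ‖·‖f Q‖ ≤ fixedTupleL1 …` — the two-leg symbol in natural units is below the plain line.
[cite: BenfattoGiulianiMastropietro2006, §2.3 (2.17)] -/
theorem beta_mul_norm_symbol_le_fixedTupleL1_two_of_conserving {β : ℝ} (hβ : 0 < β) (𝒱 : HubbardGrassmann L M) (σ : Fin 2 → Fin 2) (κ : ℂ)
    (f : TorusSite 1 (2 * M) × TorusSite 2 L → ℂ)
    (hker : ∀ k : Fin 2 → FreqMomentum L M, kernel ℂ 𝒱 2 (fun i => ((k i, σ i), (![0, 1] : Fin 2 → Fin 2) i)) = κ * (if ((fun _ : Fin 1 => (((k 0).1 : ℕ) : ZMod (2 * M))), (k 0).2) = (((fun _ : Fin 1 => (((k 1).1 : ℕ) : ZMod (2 * M))), (k 1).2) : TorusSite 1 (2 * M) × TorusSite 2 L) then f ((fun _ : Fin 1 => (((k 0).1 : ℕ) : ZMod (2 * M))), (k 0).2) else 0))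
    (y : SpaceTimeIdx L M) (Q : TorusSite 1 (2 * M) × TorusSite 2 L) :
    β * (L : ℝ) ^ 2 * ‖κ‖ * ‖f Q‖ ≤
      fixedTupleL1 L M β 1 (sectorisedKernel L M β (trivialMultiplier L M) 𝒱 2) (fun i : Fin 2 => ((((0 : Fin 1), σ i) : Fin 1 × Fin 2), (![0, 1] : Fin 2 → Fin 2) i)) y := by
  have h := norm_symbol_le_fixedTupleL1_two_of_conserving hβ 𝒱 σ κ f hker y Q
  have hM0 : (0 : ℝ) < M := Nat.cast_pos.2 (Nat.pos_of_ne_zero (NeZero.ne M))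
  have hεM : imagTimeWeight β M * (((2 * M : ℕ) : ℝ)) = β := by
    unfold imagTimeWeight; push_cast; field_simp
  calc β * (L : ℝ) ^ 2 * ‖κ‖ * ‖f Q‖ = (imagTimeWeight β M * (((2 * M : ℕ) : ℝ))) * (L : ℝ) ^ 2 * ‖κ‖ * ‖f Q‖ := by rw [hεM]
    _ = imagTimeWeight β M * ‖κ‖ * ((((2 * M : ℕ) : ℝ)) * (L : ℝ) ^ 2) * ‖f Q‖ := by ring
    _ ≤ _ := h

/-! ### §3 The weighted line at the pinned leg `0` dominates the plain line -/

omit [NeZero M] in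
/-- Re-indexing the pinned sum at leg `0` of a `2`-tuple: `Σ_{x′ : x′ 0 = y} F x′ = Σ_{x : Fin 1 → _} F (vecCons y x)`. [folklore] -/
theorem sum_filter_pin_zero_eq_sum_vecCons (F : (Fin 2 → SpaceTimeIdx L M) → ℝ) (y : SpaceTimeIdx L M) :
    ∑ x' ∈ univ.filter (fun x' : Fin 2 → SpaceTimeIdx L M => x' 0 = y), F x' = ∑ x : Fin 1 → SpaceTimeIdx L M, F (Matrix.vecCons y x) := by
  classical
  refine Finset.sum_bij' (fun x' _ => fun i : Fin 1 => x' i.succ) (fun x _ => Matrix.vecCons y x) ?_ ?_ ?_ ?_ ?_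
  · intro x' _; exact mem_univ _
  · intro x _
    simp only [mem_filter, mem_univ, true_and]
    rfl
  · intro x' hx'
    simp only [mem_filter, mem_univ, true_and] at hx'
    funext i
    refine Fin.cases ?_ (fun j => ?_) i
    · simpa using hx'.symm
    · simp [Matrix.vecCons, Fin.cons_succ]
  · intro x _
    funext i
    simp [Matrix.vecCons, Fin.cons_succ]
  · intro x' hx'
    simp only [mem_filter, mem_univ, true_and] at hx'
    congr 1
    funext i
    refine Fin.cases ?_ (fun j => ?_) i
    · simpa using hx'
    · simp [Matrix.vecCons, Fin.cons_succ]

omit [NeZero M] in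
/-- **THE WEIGHTED PLAIN TWO-LEG LINE AT THE PINNED LEG `0` DOMINATES THE PLAIN LINE** (`1 ≤ klScaleWt`): for every `j`, label string `τ` and pin `y`,
`fixedTupleL1 L M β 1 W τ y ≤ ε·Σ_{x′ : x′ 0 = y} klScaleWt_j(pos x′)·‖W τ x′‖`. [folklore] -/
theorem fixedTupleL1_le_wtPinnedLine_zero {N : ℕ} {β : ℝ} (hβ : 0 ≤ β) (W : (Fin 2 → SectorLeg N) → (Fin 2 → SpaceTimeIdx L M) → ℂ)
    (τ : Fin 2 → SectorLeg N) (j : ℕ) (y : SpaceTimeIdx L M) :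
    fixedTupleL1 L M β 1 W τ y ≤
      imagTimeWeight β M ^ 1 * ∑ x' ∈ univ.filter (fun x' : Fin 2 → SpaceTimeIdx L M => x' 0 = y),
        klScaleWt L M β j ((univ.image x').image (fun x : SpaceTimeIdx L M => (((((2 * (x.1 : ℕ) : ℕ)) : ZMod (2 * (2 * M)))), x.2))) * ‖W τ x'‖ := by
  classical
  unfold fixedTupleL1
  refine mul_le_mul_of_nonneg_left ?_ (pow_nonneg (imagTimeWeight_nonneg hβ M) 1)
  have hre := sum_filter_pin_zero_eq_sum_vecCons (fun x' => klScaleWt L M β j ((univ.image x').image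
    (fun x : SpaceTimeIdx L M => (((((2 * (x.1 : ℕ) : ℕ)) : ZMod (2 * (2 * M)))), x.2))) * ‖W τ x'‖) y
  rw [hre]
  refine sum_le_sum fun x _ => ?_
  exact le_mul_of_one_le_left (norm_nonneg _) (one_le_klScaleWt L M β j _)

/-- **THE WEIGHTED PLAIN TWO-LEG LINE DOMINATES THE SYMBOL** — the kernel object of «(b)-WT4-2LEG-PLAIN-CURRENCY»: for `K k = κ·[k̄₀ = k̄₁]·f(k̄₀)` on the
string `((0,σ i),![0,1] i)`, every rate `j`, pin `y` and frequency–momentum `Q`: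
`β·L²·‖κ‖·‖f Q‖ ≤ ε·Σ_{x′ : x′ 0 = y} klScaleWt_j(pos x′)·‖sectorisedKernel … trivialMultiplier 𝒱 2 ((0,σ i),![0,1] i) x′‖` — so ♯4 D's binder `hS₂` at block `k`
forces `βL²‖κ‖·sup_Q‖f Q‖ ≤ S₂·4^{−(dk−1)}`. [cite: BenfattoGiulianiMastropietro2006, §2.3 (2.17)] -/
theorem norm_symbol_le_wtPinnedLine_two_of_conserving {β : ℝ} (hβ : 0 < β) (𝒱 : HubbardGrassmann L M) (σ : Fin 2 → Fin 2) (κ : ℂ)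
    (f : TorusSite 1 (2 * M) × TorusSite 2 L → ℂ)
    (hker : ∀ k : Fin 2 → FreqMomentum L M, kernel ℂ 𝒱 2 (fun i => ((k i, σ i), (![0, 1] : Fin 2 → Fin 2) i)) = κ * (if ((fun _ : Fin 1 => (((k 0).1 : ℕ) : ZMod (2 * M))), (k 0).2) = (((fun _ : Fin 1 => (((k 1).1 : ℕ) : ZMod (2 * M))), (k 1).2) : TorusSite 1 (2 * M) × TorusSite 2 L) then f ((fun _ : Fin 1 => (((k 0).1 : ℕ) : ZMod (2 * M))), (k 0).2) else 0))
    (j : ℕ) (y : SpaceTimeIdx L M) (Q : TorusSite 1 (2 * M) × TorusSite 2 L) :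
    β * (L : ℝ) ^ 2 * ‖κ‖ * ‖f Q‖ ≤
      imagTimeWeight β M ^ 1 * ∑ x' ∈ univ.filter (fun x' : Fin 2 → SpaceTimeIdx L M => x' 0 = y),
        klScaleWt L M β j ((univ.image x').image (fun x : SpaceTimeIdx L M => (((((2 * (x.1 : ℕ) : ℕ)) : ZMod (2 * (2 * M)))), x.2))) *
          ‖sectorisedKernel L M β (trivialMultiplier L M) 𝒱 2 (fun i : Fin 2 => ((((0 : Fin 1), σ i) : Fin 1 × Fin 2), (![0, 1] : Fin 2 → Fin 2) i)) x'‖ :=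
  (beta_mul_norm_symbol_le_fixedTupleL1_two_of_conserving hβ 𝒱 σ κ f hker y Q).trans
    (fixedTupleL1_le_wtPinnedLine_zero hβ.le _ _ j y)

end Summit.HubbardSuperconductivity.HubbardSuperconductivity.Theorems.TorusFourierL2

end
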